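import Summits.QuantumFields.YangMills.Theorems.UnitScaleTiltProp7BlockPoincareKerTopMean
import HarnessLib

/-!
# Route `UnitScaleTilt`, crux «MinimiserStabilityRegPr» (stmt-QuantumFields-19200, stub EX), positivity block, the LOD ∕ Combes–Thomas line of ★p1 g24's
# `LOCATE-P349-CT` v2 §7 (E2) (★★OWNER RULINGS №33∕№34) — **BRICK (L2′-GAP), FILE 1∕2 «THE KEPT-MEAN SOCKET»: the block covariant Poincaré inequality with the COMB
# MEAN BOUNDED BY A DISPLAYED QUANTITY plus a small multiple of the block mass, and the tower induction WITHOUT the kernel condition** — the two engines of the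
# all-`λ` gap `‖toL2S λ‖² ≤ 2·‖D^η_{U₀}(toL2S λ)‖² + 16·c₀·(L^{K−n})³·Σ_y ‖(Q″(toL2S λ))(y)‖²` of the massive covariant operator `Δ′_a = Δ_U + aQ″†Q″` (FILE 2∕2
# `…Prop7BlockPoincareTopMeanKept` plugs ROW-T and displays it in ✓p746531's `Q''`-currency; ym3-torus-px5 g11, `LOCATE-L2gap-px5g11.md`).

Cell `ym3-torus` (HUMAN RULING D-0037: YM₃ on T³ is ladder rung R3 — NOT d = 4, NOT infinite volume, NOT a mass gap, NOT Clay).  Width seat `ym3-torus-px5` (gen 11; WIDTH COPY of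
ym3-torus-p1).  THEOREMS ONLY (0 `def`, 0 `sorry`); `--supports stmt-QuantumFields-19200 --as helper`, count-neutral.  HONEST LABEL (№33 (6)∕№34): «curved γ-row supplier line (LOD
localisation); one Thm 3.1-class Agmon brick (L3′) inside, Track A road cited; nothing of EX∕19200 proved».

THE POINT.  The repaired line (memo §7 (E2) = print's (3.25): `P = 1 − R = G_aQ″†(Q″G_a²Q″†)⁻¹Q″G_a`, `G_a := (Δ_U + aQ″†Q″)⁻¹`) starts from the EXISTENCE of `G_a` with a
K-UNIFORM bound `‖G_a‖ ≤ 1∕m` — print's `Δ′_a ≥ γ₀` ([Balaban1983RegularityDecay] (1.8) p.573: «the constant `γ₀` is independent of the lattice spacing `η`, as well as of `Ω` and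
of `A`»; Prop 3.1′ (1.22) p.574; [Balaban1985BackgroundPropagators] (3.24) p.394, Thm 3.11 p.416 «`Δ′_a, G′, (Q′G′²Q′*)⁻¹` … are positive definite»).  In the lane's weighted letters
(`‖toL2S l‖² = c₀ΣΣ|l_{jk}|²`, `‖D^η(toL2S l)‖² = c₀η⁻²Σ_b‖U₀(b)l(b₊)U₀(b)⋆ − l(b₋)‖²_F`) the natural coarse weight is `c₀η⁻³` (the fine norm of the block-constant lift; `= 1` at
print's `c₀ = η³`, unit coarse lattice), and the row reads `‖λ‖² ≤ 2‖D_Uλ‖² + 16·[c₀η⁻³Σ_y‖(Q″λ)_y‖²]`, i.e. `Δ′_a ≥ min(½, a∕16)` — constants free of `L`, of `k = K − n`, of the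
volume.  WHY NOT «(L1) ⊕ mass» in two lines: the orthogonal split `λ = P_Nλ + (1 − P_N)λ` leaves a cross term `2re⟨D P_Nλ, D(1 − P_N)λ⟩` controlled only through `‖D^η‖ ~ η⁻¹`.
The KEPT-MEAN Poincaré has no split: ✓`Prop7NestedMeanPoincare.sum_normSq_le_combMean_add_covGrad` keeps the COMB mean, and the SAME tower induction (L1) uses
(✓`norm_ns_sub_refMean_le_of_lt`) bounds the comb mean by the nested mean PLUS the `δ`-small block mass; the reference swap then costs `2δ²` instead of `δ²`.

WHAT IS PROVED (sorry-free, no definition; ns `…Theorems.Prop7BlockPoincareTopMeanKept`).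
* §1 (generic `P, i, i′, e, N`) ★`sum_normSq_le_covGrad_add_of_combMean_le` — comb means `‖Σ_r Ad_{V(Γ_{ȳ,x_r})} f(x_r)‖ ≤ A_y + δ·Σ_r‖f(x_r)‖`, window
  `N d³((L^e)²a)² + 2Nδ² ≤ ½` ⊢ `Σ‖f‖² ≤ (N∕2)(L^e)²·Σ‖∇^Vf‖² + 4N·(L^{ed})⁻¹·Σ_y A_y²`.
* §2 (generic `P`, `k₀ ≤ m + K`) ★`norm_combSum_le_add_of_ns` — ✓`norm_combSum_le_of_ns_eq_zero` WITHOUT `hker`: `‖Σ_r Ad_{W_{y,r}} l(x_{y,r})‖ ≤ (L^d)^{k₀}·‖ns_{k₀}(y)‖ +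
  (2Σ_{j<k₀}η_j + 2η′)·Σ_r‖l(x_{y,r})‖`.
* §3 (T³ member) ★★`normSq_toL2S_le_two_mul_add_of_combMean_le` (socket: comb means `≤ A_y + δ·mass`, window `108ε² + 8δ² ≤ 1` ⊢ `‖toL2S l‖² ≤ 2‖DL2(toL2S l)‖² +
  16c₀((L^{K−n})³)⁻¹Σ_y A_y²`) and `window8_T3` (`108ε₀² + 8(2Ση_j)² ≤ 1` under `10⁷L³ε₀ ≤ 1`, ROW-T's `η_j`).
HONEST SCOPE.  Finite-sum bookkeeping over landed rows; no operator `G_a`, no decay, no `Q″†` letter (no inner product of record on the coarse side yet — the sums are displayed);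
nothing of (L3′)–(L5′), (3.49), Thm 3.1∕3.3∕3.11, `h349`, `hGF`, EX or the crux is proved here; nothing continuum ∕ OS ∕ mass-gap ∕ Clay.

References: T. Bałaban, CMP **89** (1983) 571–597 [Balaban1983RegularityDecay] ((1.8) p.573, Prop 3.1′ (1.22) p.574, (2.27) p.580); CMP **99** (1985) 389–434
[Balaban1985BackgroundPropagators] ((3.19) p.393, (3.24)–(3.25) p.394, Thm 3.11 p.416); CMP **95** (1984) 17–40 [Balaban1984PropagatorsI] ((1.42)–(1.44) pp.25–26);
CMP **98** (1985) 17–51 [Balaban1985Averaging] ((97) p.32, pp.24–25); CMP **102** (1985) 277–309 [Balaban1985Variational] ((2) p.278).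
-/

set_option autoImplicit false

noncomputable section

open scoped BigOperators Matrix.Norms.L2Operator

namespace Summit.QuantumFields.YangMills.Theorems.Prop7BlockPoincareTopMeanKept

open Literature.MathematicalPhysics.QuantumFieldTheory.Balaban1983to89
open Finset
open T4Continuum BlockAveraging
open BlockAveraging (Idx)
open B7Prop1Explicit (U1 mem_U1 treeWord plaqWord disp)
open B7Eq78Linearization (conjR conjR_apply conjR_sub conjR_smul_real)
open B8Ineq132 (norm_conjR conjR_conjR one_conjR conjR_sum)
open B5Eq118OneStroke (iterBlockOf iterBlock mem_iterBlock iterBlock_zero sum_iterBlock_succ)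
open B15DeterminingSets (embIter)
open B10Eq27TorusAxialLog (holT axialT transl unitsField toUField)
open B7TransferAnalyticMean (meanCLM)
open B5Leaf237C0Torus (sum_chart)
open Summit.QuantumFields.YangMills.Theorems.Prop7CovariantCoercivity (norm_conjR_sub_conjR_le hyp_of_specialUnitary)
open Summit.QuantumFields.YangMills.Theorems.Prop8Chart (emlIterU)
open Summit.QuantumFields.YangMills.Theorems.Prop7NestedMeanPoincare
  (sum_normSq_le_combMean_add_covGrad normSq_toL2S_le_two_mul mul_sum_normSq_covGrad_le_normSq_DL2 conjR_unitsField_toUField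
    hstep_of_hsucc norm_ns_sub_refMean_le_of_lt)

variable {N : ℕ} [NeZero N]

/-! ## §1 The block Poincaré inequality with the comb mean bounded by a displayed quantity plus a small multiple of the block mass -/

section Generic

variable {P : Params} {i i' e : ℕ}

/-- ★ **SMALL-FIELD FORM ON «COMB MEANS `≤ A_y + δ·mass`»** (the kept-mean socket): if the plaquette variables of `V` are within `a` of `1`,
`N d³((L^e)²a)² + 2Nδ² ≤ ½`, and on every block the comb mean of `f` is bounded by a displayed `A_y ≥ 0` plus `δ` times the block mass,
`‖Σ_r Ad_{V(Γ_{ȳ,x_r})} f(x_r)‖ ≤ A_y + δ·Σ_r‖f(x_r)‖`, then `Σ_x‖f x‖² ≤ (N∕2)(L^e)²·Σ_νΣ_x‖(∇^V_νf)(x)‖² + 4N·(L^{ed})⁻¹·Σ_y A_y²`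
(✓`sum_normSq_le_combMean_add_covGrad` + `(A + δM)² ≤ 2A² + 2δ²M²` + Cauchy–Schwarz on the block mass).  The case `A ≡ 0` is ✓`sum_normSq_le_covGrad_of_combMean_small`.
[cite: Balaban1983RegularityDecay, (1.8) p.573, (2.27) p.580; Balaban1985BackgroundPropagators, Thm 3.11 p.416] -/
theorem sum_normSq_le_covGrad_add_of_combMean_le {V : GaugeField P i (Matrix (Fin N) (Fin N) ℂ)ˣ} (hV : ∀ b, V b ∈ U1 (Matrix (Fin N) (Fin N) ℂ))
    {a δ : ℝ} (ha : 0 ≤ a) (hδ : 0 ≤ δ)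
    (hplaq : ∀ (x : Site P i) (κ μ : Fin P.d), κ ≠ μ → ‖((holT V x (plaqWord κ μ) : (Matrix (Fin N) (Fin N) ℂ)ˣ) : Matrix (Fin N) (Fin N) ℂ) - 1‖ ≤ a)
    (hsmall : N * P.d ^ 3 * (((P.L : ℝ) ^ e) ^ 2 * a) ^ 2 + 2 * N * δ ^ 2 ≤ 1 / 2)
    (h : P.sitesPerDir i = P.L ^ e * P.sitesPerDir i') (f : Site P i → Matrix (Fin N) (Fin N) ℂ)
    (A : Site P i' → ℝ) (hA : ∀ y, 0 ≤ A y)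
    (hcomb : ∀ y : Site P i', ‖∑ r : Fin P.d → Fin (P.L ^ e),
        conjR (holT V (Site.fibreSite i e y fun _ => ⟨0, pow_pos P.L_pos e⟩) (treeWord fun ν => ((r ν : ℕ) : ℤ))) (f (Site.fibreSite i e y r))‖
      ≤ A y + δ * ∑ r : Fin P.d → Fin (P.L ^ e), ‖f (Site.fibreSite i e y r)‖) :
    ∑ x : Site P i, ‖f x‖ ^ 2
      ≤ (N / 2) * ((P.L : ℝ) ^ e) ^ 2 * ∑ ν : Fin P.d, ∑ x : Site P i, ‖conjR (V ⟨x, ν⟩) (f (x.shift ν)) - f x‖ ^ 2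
        + 4 * N * (((P.L : ℝ) ^ e) ^ P.d)⁻¹ * ∑ y : Site P i', A y ^ 2 := by
  have hmain := sum_normSq_le_combMean_add_covGrad hV ha hplaq h f
  have hcard : (Fintype.card (Fin P.d → Fin (P.L ^ e)) : ℝ) = ((P.L : ℝ) ^ e) ^ P.d := by
    rw [Fintype.card_fun, Fintype.card_fin, Fintype.card_fin]; push_cast; ring
  -- per block: `‖comb‖² ≤ 2A² + 2δ²·card·Σ‖f_r‖²`
  have hblock : ∀ y : Site P i', ‖∑ r : Fin P.d → Fin (P.L ^ e),
      conjR (holT V (Site.fibreSite i e y fun _ => ⟨0, pow_pos P.L_pos e⟩) (treeWord fun ν => ((r ν : ℕ) : ℤ))) (f (Site.fibreSite i e y r))‖ ^ 2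
        ≤ 2 * A y ^ 2 + 2 * (δ ^ 2 * ((P.L : ℝ) ^ e) ^ P.d * ∑ r : Fin P.d → Fin (P.L ^ e), ‖f (Site.fibreSite i e y r)‖ ^ 2) := by
    intro y
    set M : ℝ := ∑ r : Fin P.d → Fin (P.L ^ e), ‖f (Site.fibreSite i e y r)‖ with hM
    have hM0 : 0 ≤ M := Finset.sum_nonneg fun _ _ => norm_nonneg _
    have h0 : 0 ≤ A y + δ * M := add_nonneg (hA y) (mul_nonneg hδ hM0)
    have h1 := pow_le_pow_left₀ (norm_nonneg _) (hcomb y) 2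
    have h2 : M ^ 2 ≤ Fintype.card (Fin P.d → Fin (P.L ^ e)) * ∑ r : Fin P.d → Fin (P.L ^ e), ‖f (Site.fibreSite i e y r)‖ ^ 2 := by
      have := sq_sum_le_card_mul_sum_sq (s := (Finset.univ : Finset (Fin P.d → Fin (P.L ^ e)))) (f := fun r => ‖f (Site.fibreSite i e y r)‖)
      simpa [hM] using this
    rw [hcard] at h2
    have h3 : (A y + δ * M) ^ 2 ≤ 2 * A y ^ 2 + 2 * (δ ^ 2 * M ^ 2) := by nlinarith [sq_nonneg (A y - δ * M)]
    have h4 : δ ^ 2 * M ^ 2 ≤ δ ^ 2 * (((P.L : ℝ) ^ e) ^ P.d * ∑ r : Fin P.d → Fin (P.L ^ e), ‖f (Site.fibreSite i e y r)‖ ^ 2) :=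
      mul_le_mul_of_nonneg_left h2 (sq_nonneg _)
    calc _ ≤ (A y + δ * M) ^ 2 := h1
      _ ≤ 2 * A y ^ 2 + 2 * (δ ^ 2 * M ^ 2) := h3
      _ ≤ 2 * A y ^ 2 + 2 * (δ ^ 2 * (((P.L : ℝ) ^ e) ^ P.d * ∑ r : Fin P.d → Fin (P.L ^ e), ‖f (Site.fibreSite i e y r)‖ ^ 2)) := by linarith [h4]
      _ = _ := by ring
  have hsumB : ∑ y : Site P i', ‖∑ r : Fin P.d → Fin (P.L ^ e),
      conjR (holT V (Site.fibreSite i e y fun _ => ⟨0, pow_pos P.L_pos e⟩) (treeWord fun ν => ((r ν : ℕ) : ℤ))) (f (Site.fibreSite i e y r))‖ ^ 2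
        ≤ 2 * ∑ y : Site P i', A y ^ 2 + 2 * (δ ^ 2 * ((P.L : ℝ) ^ e) ^ P.d * ∑ x : Site P i, ‖f x‖ ^ 2) := by
    refine (Finset.sum_le_sum fun y _ => hblock y).trans (le_of_eq ?_)
    rw [Finset.sum_add_distrib, ← Finset.mul_sum, ← Finset.mul_sum, ← Finset.mul_sum, sum_chart P h (fun x => ‖f x‖ ^ 2)]
  have hLpos : (0 : ℝ) < ((P.L : ℝ) ^ e) ^ P.d := by have := P.L_pos; positivity
  have hN0 : (0 : ℝ) ≤ N := Nat.cast_nonneg _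
  have hm : (N : ℝ) * (((P.L : ℝ) ^ e) ^ P.d)⁻¹ * ∑ y : Site P i', ‖∑ r : Fin P.d → Fin (P.L ^ e),
      conjR (holT V (Site.fibreSite i e y fun _ => ⟨0, pow_pos P.L_pos e⟩) (treeWord fun ν => ((r ν : ℕ) : ℤ))) (f (Site.fibreSite i e y r))‖ ^ 2
        ≤ 2 * N * (((P.L : ℝ) ^ e) ^ P.d)⁻¹ * ∑ y : Site P i', A y ^ 2 + 2 * N * δ ^ 2 * ∑ x : Site P i, ‖f x‖ ^ 2 := by
    have h1 := mul_le_mul_of_nonneg_left hsumB (by positivity : (0 : ℝ) ≤ N * (((P.L : ℝ) ^ e) ^ P.d)⁻¹)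
    refine h1.trans (le_of_eq ?_)
    have e1 : (N : ℝ) * (((P.L : ℝ) ^ e) ^ P.d)⁻¹ * (2 * ∑ y : Site P i', A y ^ 2 + 2 * (δ ^ 2 * ((P.L : ℝ) ^ e) ^ P.d * ∑ x : Site P i, ‖f x‖ ^ 2))
        = 2 * N * (((P.L : ℝ) ^ e) ^ P.d)⁻¹ * ∑ y : Site P i', A y ^ 2
          + 2 * N * δ ^ 2 * (∑ x : Site P i, ‖f x‖ ^ 2) * ((((P.L : ℝ) ^ e) ^ P.d)⁻¹ * ((P.L : ℝ) ^ e) ^ P.d) := by ring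
    rw [e1, inv_mul_cancel₀ hLpos.ne', mul_one]
  have hS0 : 0 ≤ ∑ x : Site P i, ‖f x‖ ^ 2 := Finset.sum_nonneg fun _ _ => sq_nonneg _
  have hG0 : 0 ≤ ∑ ν : Fin P.d, ∑ x : Site P i, ‖conjR (V ⟨x, ν⟩) (f (x.shift ν)) - f x‖ ^ 2 :=
    Finset.sum_nonneg fun _ _ => Finset.sum_nonneg fun _ _ => sq_nonneg _
  have hA0 : 0 ≤ (((P.L : ℝ) ^ e) ^ P.d)⁻¹ * ∑ y : Site P i', A y ^ 2 :=
    mul_nonneg (inv_nonneg.mpr hLpos.le) (Finset.sum_nonneg fun _ _ => sq_nonneg _)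
  have h2 := mul_le_mul_of_nonneg_right hsmall hS0
  nlinarith [hmain, hm, h2, hG0, hA0]

end Generic

/-! ## §2 The tower induction WITHOUT `ns_{k₀} = 0`: the top comb sum is the nested mean (rescaled) plus a small multiple of the block mass -/

section Comb

variable {P : Params}

/-- ★ **THE TOP-LEVEL COMB SUM AGAINST THE NESTED MEAN, KEPT**: with the data of ✓`norm_ns_sub_refMean_le_of_lt` (unitary transports `T_{j,y,i}` and references `C_{j,z,x}`
below∕at the target level `k₀ ≤ m + K`, the mean-form recursion `hstep`, per-level closeness `η_j`) and a top-level comb family `W_{y,r}` (unitary) with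
`‖C_{k₀,y,x_{y,r}} − g_y·W_{y,r}‖ ≤ η′` (`g_y` unitary, `x_{y,r} = fibreSite 0 k₀ y r`), on every top block
`‖Σ_r Ad_{W_{y,r}} l(x_{y,r})‖ ≤ (L^d)^{k₀}·‖ns_{k₀}(y)‖ + (2Σ_{j<k₀}η_j + 2η′)·Σ_r‖l(x_{y,r})‖` — ✓`norm_combSum_le_of_ns_eq_zero` is the case `ns_{k₀} = 0`
(same proof: divide the induction's bound by `(L^d)^{−k₀}`, keep `‖ns_{k₀}(y)‖`, re-index the block by offsets ✓`sum_iterBlock_eq`, swap `C` for `g·W` at cost `2η′`, `Ad_g` isometric).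
[cite: Balaban1985Averaging, (97) p.32, pp.24–25; Balaban1984PropagatorsI, (1.18) p.20; Balaban1985BackgroundPropagators, (3.19) p.393] -/
theorem norm_combSum_le_add_of_ns {k₀ : ℕ} (hk₀ : k₀ ≤ P.m + P.K)
    (T : (j : ℕ) → Site P (j + 1) → Idx P → (Matrix (Fin N) (Fin N) ℂ)ˣ) (hT : ∀ j, j < k₀ → ∀ y i, T j y i ∈ U1 (Matrix (Fin N) (Fin N) ℂ))
    (ns : (j : ℕ) → Site P j → Matrix (Fin N) (Fin N) ℂ) (l : Site P 0 → Matrix (Fin N) (Fin N) ℂ) (h0 : ∀ x, ns 0 x = l x)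
    (hstep : ∀ j, j < k₀ → ∀ (y : Site P (j + 1)), ns (j + 1) y = ((Fintype.card (Idx P) : ℝ)⁻¹) • ∑ i : Idx P, conjR (T j y i) (ns j (Site.blockSite y i.1)))
    (C : (j : ℕ) → Site P j → Site P 0 → (Matrix (Fin N) (Fin N) ℂ)ˣ) (hC : ∀ j, j ≤ k₀ → ∀ z x, C j z x ∈ U1 (Matrix (Fin N) (Fin N) ℂ)) (hC0 : ∀ x, C 0 x x = 1)
    (η : ℕ → ℝ)
    (hclose : ∀ j, j < k₀ → ∀ (y : Site P (j + 1)) (i : Idx P), ∀ x ∈ iterBlock j (Site.blockSite y i.1),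
      ‖((T j y i : (Matrix (Fin N) (Fin N) ℂ)ˣ) : Matrix (Fin N) (Fin N) ℂ) * (C j (Site.blockSite y i.1) x : Matrix (Fin N) (Fin N) ℂ) - (C (j + 1) y x : Matrix (Fin N) (Fin N) ℂ)‖ ≤ η j)
    (W : Site P k₀ → (Fin P.d → Fin (P.L ^ k₀)) → (Matrix (Fin N) (Fin N) ℂ)ˣ) (hW : ∀ y r, W y r ∈ U1 (Matrix (Fin N) (Fin N) ℂ))
    (g : Site P k₀ → (Matrix (Fin N) (Fin N) ℂ)ˣ) (hg : ∀ y, g y ∈ U1 (Matrix (Fin N) (Fin N) ℂ)) {η' : ℝ}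
    (htop : ∀ (y : Site P k₀) (r : Fin P.d → Fin (P.L ^ k₀)),
      ‖(C k₀ y (Site.fibreSite 0 k₀ y r) : Matrix (Fin N) (Fin N) ℂ) - (g y : Matrix (Fin N) (Fin N) ℂ) * (W y r : Matrix (Fin N) (Fin N) ℂ)‖ ≤ η')
    (y : Site P k₀) :
    ‖∑ r : Fin P.d → Fin (P.L ^ k₀), conjR (W y r) (l (Site.fibreSite 0 k₀ y r))‖
      ≤ (((P.L : ℝ) ^ P.d) ^ k₀) * ‖ns k₀ y‖ + (2 * ∑ j ∈ range k₀, η j + 2 * η') * ∑ r : Fin P.d → Fin (P.L ^ k₀), ‖l (Site.fibreSite 0 k₀ y r)‖ := by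
  have hmain := norm_ns_sub_refMean_le_of_lt hk₀ T hT ns l h0 hstep C hC hC0 η hclose k₀ le_rfl y
  set c : ℝ := ((((P.L : ℝ) ^ P.d) ^ k₀)⁻¹) with hc
  have hL0 : (0 : ℝ) < ((P.L : ℝ) ^ P.d) ^ k₀ := by have := P.L_pos; positivity
  have hc0 : 0 < c := by rw [hc]; positivity
  have hcinv : c⁻¹ = ((P.L : ℝ) ^ P.d) ^ k₀ := by rw [hc, inv_inv]
  set δ : ℝ := 2 * ∑ j ∈ range k₀, η j with hδ
  -- re-index the top block by offsets
  have eS : ∑ x ∈ iterBlock k₀ y, conjR (C k₀ y x) (l x) = ∑ r : Fin P.d → Fin (P.L ^ k₀), conjR (C k₀ y (Site.fibreSite 0 k₀ y r)) (l (Site.fibreSite 0 k₀ y r)) :=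
    B5Eq117TorusCarriers.sum_iterBlock_eq hk₀ y _
  have eM : ∑ x ∈ iterBlock k₀ y, ‖l x‖ = ∑ r : Fin P.d → Fin (P.L ^ k₀), ‖l (Site.fibreSite 0 k₀ y r)‖ :=
    B5Eq117TorusCarriers.sum_iterBlock_eq hk₀ y _
  set S : Matrix (Fin N) (Fin N) ℂ := ∑ r : Fin P.d → Fin (P.L ^ k₀), conjR (C k₀ y (Site.fibreSite 0 k₀ y r)) (l (Site.fibreSite 0 k₀ y r)) with hS
  set Ml : ℝ := ∑ r : Fin P.d → Fin (P.L ^ k₀), ‖l (Site.fibreSite 0 k₀ y r)‖ with hMl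
  have hMl0 : 0 ≤ Ml := Finset.sum_nonneg fun _ _ => norm_nonneg _
  -- `‖S‖ ≤ c⁻¹‖ns_{k₀} y‖ + δ·Ml`
  rw [eS, eM] at hmain
  have hS1 : ‖S‖ ≤ c⁻¹ * ‖ns k₀ y‖ + δ * Ml := by
    -- `‖c•S‖ ≤ ‖ns y‖ + ‖ns y − c•S‖ ≤ ‖ns y‖ + δ c Ml`
    have h1 : c * ‖S‖ ≤ ‖ns k₀ y‖ + δ * (c * Ml) := by
      have htri : ‖c • S‖ ≤ ‖ns k₀ y‖ + ‖ns k₀ y - c • S‖ := by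
        have := norm_sub_le (ns k₀ y) (ns k₀ y - c • S)
        rw [sub_sub_cancel] at this
        exact this
      rw [norm_smul, Real.norm_of_nonneg hc0.le] at htri
      rw [hS, hMl]
      linarith [hmain, htri]
    have h2 : ‖S‖ ≤ c⁻¹ * (‖ns k₀ y‖ + δ * (c * Ml)) := by
      rw [le_inv_mul_iff₀ hc0]; exact h1
    have h3 : c⁻¹ * (‖ns k₀ y‖ + δ * (c * Ml)) = c⁻¹ * ‖ns k₀ y‖ + δ * Ml := by
      field_simp
    linarith [h2, h3.le]
  -- swap `C_{k₀,y,x_r}` for `g_y·W_{y,r}`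
  have hS2 : ‖∑ r : Fin P.d → Fin (P.L ^ k₀), conjR (g y * W y r) (l (Site.fibreSite 0 k₀ y r)) - S‖ ≤ 2 * η' * Ml := by
    rw [hS, ← Finset.sum_sub_distrib]
    refine (norm_sum_le _ _).trans ?_
    rw [hMl, Finset.mul_sum]
    refine Finset.sum_le_sum fun r _ => ?_
    refine (norm_conjR_sub_conjR_le (hC k₀ le_rfl y _) ((U1 _).mul_mem (hg y) (hW y r)) _).trans ?_
    rw [Units.val_mul, norm_sub_rev]
    exact mul_le_mul_of_nonneg_right (mul_le_mul_of_nonneg_left (htop y r) (by norm_num)) (norm_nonneg _)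
  -- `Ad_g` is an isometry
  have hiso : ‖∑ r : Fin P.d → Fin (P.L ^ k₀), conjR (W y r) (l (Site.fibreSite 0 k₀ y r))‖ = ‖∑ r : Fin P.d → Fin (P.L ^ k₀), conjR (g y * W y r) (l (Site.fibreSite 0 k₀ y r))‖ := by
    rw [← norm_conjR (hg y), conjR_sum]
    congr 1
    exact Finset.sum_congr rfl fun r _ => conjR_conjR _ _ _
  rw [hiso, ← hcinv]
  calc ‖∑ r : Fin P.d → Fin (P.L ^ k₀), conjR (g y * W y r) (l (Site.fibreSite 0 k₀ y r))‖
      ≤ ‖∑ r : Fin P.d → Fin (P.L ^ k₀), conjR (g y * W y r) (l (Site.fibreSite 0 k₀ y r)) - S‖ + ‖S‖ := norm_le_norm_sub_add _ _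
    _ ≤ 2 * η' * Ml + (c⁻¹ * ‖ns k₀ y‖ + δ * Ml) := add_le_add hS2 hS1
    _ = c⁻¹ * ‖ns k₀ y‖ + (δ + 2 * η') * Ml := by ring

end Comb

/-! ## §3 The T³ member: the kept-mean socket, the displayed-data edition, the ROW-T-plugged edition -/

section T3

open Literature.MathematicalPhysics.QuantumFieldTheory.Balaban1983to89.T3ContinuumYM3Torus
open T3SectALandauChart (eta eta_pos bgUnits)
open T3RegularMinimiser (regThreshold)
open T3PrintedRegularMinimiser (RegPr)
open Summit.QuantumFields.YangMills.Theorems.Prop7SectET3HilbertLetters (toL2S DL2)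
open Summit.QuantumFields.YangMills.Theorems.Prop7SymAvgTwSym (holT_mem_U1 unitsField_toUField_mem_U1' emlIterU_bgUnits_mem_U1_of_regPr)
open Summit.QuantumFields.YangMills.Theorems.Prop7NestedMeanTowerCloseness
  (ref_T3_mem_U1 ref_T3_zero_self hclose_T3 g_T3_mem_U1 htop_T3 two_mul_sum_eta_le_T3)

variable (F : T3Family) {n K : ℕ}

/-- ★★ **THE KEPT-MEAN SOCKET AT THE T³ MEMBER.**  `dist1(U₀(∂p)) ≤ ε·L^{−2(K−n)}`, window `108ε² + 8δ² ≤ 1`: if on every top block the comb mean of `l` is bounded by a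
displayed `A_y ≥ 0` plus `δ` times the block mass, `‖Σ_r Ad_{U₀(Γ_{ȳ,x_{y,r}})} l(x_{y,r})‖ ≤ A_y + δ·Σ_r‖l(x_{y,r})‖`, then
**`‖toL2S l‖² ≤ 2·‖D^η_{U₀}(toL2S l)‖² + 16·c₀·((L^{K−n})³)⁻¹·Σ_y A_y²`** (§1 at `N = 2`, `d = 3`, `e = K − n` + brick L0a's dictionary; the case `A ≡ 0` is
✓`normSq_toL2S_le_two_mul_of_combMean_small`). [cite: Balaban1983RegularityDecay, (1.8) p.573, (2.27) p.580; Balaban1985BackgroundPropagators, (3.3) p.391, (3.24) p.394, Thm 3.11 p.416] -/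
theorem normSq_toL2S_le_two_mul_add_of_combMean_le {c₀ : ℝ} [Fact (0 < c₀)] (U₀ : GaugeField (F.P K) 0 (Matrix.specialUnitaryGroup (Fin 2) ℂ))
    {ε δ : ℝ} (hε : 0 ≤ ε) (hδ : 0 ≤ δ) (hwin : 108 * ε ^ 2 + 8 * δ ^ 2 ≤ 1)
    (hU : ∀ p : Plaq (F.P K) 0, dist1 (GaugeField.plaqHol U₀ p) ≤ ε * (((F.L : ℝ) ^ (K - n)) ^ 2)⁻¹)
    (l : Site (F.P K) 0 → Matrix (Fin 2) (Fin 2) ℂ) (A : Site (F.P K) (K - n) → ℝ) (hA : ∀ y, 0 ≤ A y)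
    (hcomb : ∀ y : Site (F.P K) (K - n), ‖∑ r : Fin (F.P K).d → Fin ((F.P K).L ^ (K - n)),
        conjR (holT (unitsField (toUField U₀)) (Site.fibreSite 0 (K - n) y fun _ => ⟨0, pow_pos (F.P K).L_pos (K - n)⟩)
          (treeWord fun ν => ((r ν : ℕ) : ℤ))) (l (Site.fibreSite 0 (K - n) y r))‖
      ≤ A y + δ * ∑ r : Fin (F.P K).d → Fin ((F.P K).L ^ (K - n)), ‖l (Site.fibreSite 0 (K - n) y r)‖) :
    ‖toL2S F K c₀ l‖ ^ 2 ≤ 2 * ‖DL2 F n K c₀ U₀ (toL2S F K c₀ l)‖ ^ 2 + 16 * c₀ * (((F.L : ℝ) ^ (K - n)) ^ 3)⁻¹ * ∑ y : Site (F.P K) (K - n), A y ^ 2 := by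
  obtain ⟨hV, hplaq⟩ := hyp_of_specialUnitary U₀ hU
  have hc : 0 < c₀ := Fact.out
  have hLF : ((F.P K).L : ℝ) = (F.L : ℝ) := by norm_cast
  have hdN : (F.P K).d = 3 := T3ContinuumYM3Torus.T3Family.P_d F K
  have hd : ((F.P K).d : ℝ) = 3 := by norm_num [hdN]
  have hLpos : (0 : ℝ) < F.L := by have := F.hL.2; exact_mod_cast (by omega : 0 < F.L)
  have hL0 : (0 : ℝ) < ((F.L : ℝ) ^ (K - n)) ^ 2 := by positivity
  have hsmall : ((2 : ℕ) : ℝ) * (F.P K).d ^ 3 * ((((F.P K).L : ℝ) ^ (K - n)) ^ 2 * (ε * (((F.L : ℝ) ^ (K - n)) ^ 2)⁻¹)) ^ 2 + 2 * ((2 : ℕ) : ℝ) * δ ^ 2 ≤ 1 / 2 := by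
    rw [hLF, hd]
    have e1 : ((F.L : ℝ) ^ (K - n)) ^ 2 * (ε * (((F.L : ℝ) ^ (K - n)) ^ 2)⁻¹) = ε := by
      rw [mul_comm ε, ← mul_assoc, mul_inv_cancel₀ hL0.ne', one_mul]
    rw [e1]
    push_cast
    nlinarith [hwin]
  have hgen := sum_normSq_le_covGrad_add_of_combMean_le hV (by positivity) hδ hplaq hsmall (Prop7FlatCoercivity.sitesPerDir_T3 F n K) l A hA hcomb
  have ed : (((F.L : ℝ) ^ (K - n)) ^ (F.P K).d)⁻¹ = (((F.L : ℝ) ^ (K - n)) ^ 3)⁻¹ := by rw [hdN]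
  rw [hLF, ed] at hgen
  have hη : 0 < eta F n K := eta_pos F n K
  have hηL : (eta F n K)⁻¹ = (F.L : ℝ) ^ (K - n) := by
    rw [T3SectALandauChart.eta, ← inv_pow, inv_inv]
  have eG : ∑ ν : Fin (F.P K).d, ∑ x : Site (F.P K) 0, ‖conjR (unitsField (toUField U₀) ⟨x, ν⟩) (l (x.shift ν)) - l x‖ ^ 2
      = ∑ b : PBond (F.P K) 0,
        ‖((U₀ b : Matrix.specialUnitaryGroup (Fin 2) ℂ) : Matrix (Fin 2) (Fin 2) ℂ) * l b.tgt * star (((U₀ b : Matrix.specialUnitaryGroup (Fin 2) ℂ) : Matrix (Fin 2) (Fin 2) ℂ)) - l b.src‖ ^ 2 := by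
    rw [B10StarCount.sum_pbond, Finset.sum_comm]
    refine Finset.sum_congr rfl fun ν _ => Finset.sum_congr rfl fun x _ => ?_
    rw [conjR_unitsField_toUField]
    rfl
  have hgrad := mul_sum_normSq_covGrad_le_normSq_DL2 F (n := n) (c₀ := c₀) U₀ l
  rw [hηL, ← eG] at hgrad
  have h1 := normSq_toL2S_le_two_mul F (K := K) (c₀ := c₀) l
  have hA0 : 0 ≤ (((F.L : ℝ) ^ (K - n)) ^ 3)⁻¹ * ∑ y : Site (F.P K) (K - n), A y ^ 2 :=
    mul_nonneg (inv_nonneg.mpr (by positivity)) (Finset.sum_nonneg fun _ _ => sq_nonneg _)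
  have h2 : 2 * c₀ * ∑ x : Site (F.P K) 0, ‖l x‖ ^ 2
      ≤ 2 * c₀ * (((2 : ℕ) : ℝ) / 2 * ((F.L : ℝ) ^ (K - n)) ^ 2 *
          ∑ ν : Fin (F.P K).d, ∑ x : Site (F.P K) 0, ‖conjR (unitsField (toUField U₀) ⟨x, ν⟩) (l (x.shift ν)) - l x‖ ^ 2
          + 4 * ((2 : ℕ) : ℝ) * (((F.L : ℝ) ^ (K - n)) ^ 3)⁻¹ * ∑ y : Site (F.P K) (K - n), A y ^ 2) :=
    mul_le_mul_of_nonneg_left hgen (by positivity)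
  have h3 : 2 * c₀ * (((2 : ℕ) : ℝ) / 2 * ((F.L : ℝ) ^ (K - n)) ^ 2 *
          ∑ ν : Fin (F.P K).d, ∑ x : Site (F.P K) 0, ‖conjR (unitsField (toUField U₀) ⟨x, ν⟩) (l (x.shift ν)) - l x‖ ^ 2
          + 4 * ((2 : ℕ) : ℝ) * (((F.L : ℝ) ^ (K - n)) ^ 3)⁻¹ * ∑ y : Site (F.P K) (K - n), A y ^ 2)
      = 2 * (c₀ * (((F.L : ℝ) ^ (K - n)) ^ 2 *
          ∑ ν : Fin (F.P K).d, ∑ x : Site (F.P K) 0, ‖conjR (unitsField (toUField U₀) ⟨x, ν⟩) (l (x.shift ν)) - l x‖ ^ 2))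
        + 16 * c₀ * (((F.L : ℝ) ^ (K - n)) ^ 3)⁻¹ * ∑ y : Site (F.P K) (K - n), A y ^ 2 := by
    push_cast; ring
  rw [h3] at h2
  linarith [h1, h2, hgrad]

/-- **THE KEPT-MEAN SOCKET'S WINDOW** `108ε₀² + 8·(2Σ_{j<K−n}η_j + 2·0)² ≤ 1` under `10⁷L³ε₀ ≤ 1` (ROW-T: `η_j = 4500L²ε₀·Lʲη`, `2Ση_j ≤ 4500L²ε₀ ≤ ¼`, `ε₀ ≤ 1∕27`;
room to spare — the 4-window of ✓`window_T3` with the reference swap's doubled cost). [cite: Balaban1985Variational, (146) p.301; Balaban1985BackgroundPropagators, (3.19) p.393] -/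
theorem window8_T3 {ε₀ : ℝ} (hε₀ : 0 < ε₀) (hε7 : 10 ^ 7 * (F.L : ℝ) ^ 3 * ε₀ ≤ 1) :
    108 * ε₀ ^ 2 + 8 * (2 * ∑ j ∈ range (K - n), 4500 * (F.L : ℝ) ^ 2 * ε₀ * ((F.L : ℝ) ^ j * eta F n K) + 2 * 0) ^ 2 ≤ 1 := by
  have hL3 : 3 ≤ F.L := by obtain ⟨a, ha⟩ := F.hL.1; have := F.hL.2; omega
  have hL3r : (3 : ℝ) ≤ F.L := by exact_mod_cast hL3
  have hS := two_mul_sum_eta_le_T3 F (n := n) (K := K) hε₀.le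
  have hS0 : 0 ≤ 2 * ∑ j ∈ range (K - n), 4500 * (F.L : ℝ) ^ 2 * ε₀ * ((F.L : ℝ) ^ j * eta F n K) :=
    mul_nonneg (by norm_num) (sum_nonneg fun j _ => by have := (eta_pos F n K).le; positivity)
  have hA : 4500 * (F.L : ℝ) ^ 2 * ε₀ ≤ 1 / 4 := by nlinarith [hε7]
  have hB : ε₀ ≤ 1 / 27 := by nlinarith [hε7]
  rw [mul_zero, add_zero]
  nlinarith [hS, hS0, hA, hB, sq_nonneg ε₀]

end T3

end Summit.QuantumFields.YangMills.Theorems.Prop7BlockPoincareTopMeanKept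

end
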